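import Summits.QuantumAdvantage.QuantumAdvantage.Theorems.LinnikCubicClassGroupsDegreeOnePrimesEscapePerCharacterDeficitZeroSum
import Summits.QuantumAdvantage.QuantumAdvantage.Theorems.LinnikCubicClassGroupsDegreeOnePrimesEscapePerCharacterDeficitSmoothedBound
import HarnessLib

/-!
# The additive class prime number theorem, II: the zero terms of the whole family off the
# exceptional segment
Topic `Summits/QuantumAdvantage/QuantumAdvantage/Theorems`, cell B2b-1 (linnik-cubic), PART A, the
`stub_classPNTAdditive` slice of the crux `DegreeOnePrimesEscape` (stmt-QuantumAdvantage-11543), in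
DEGREE-LOCAL form.  HONEST FRAMING: the value of this file is a THEOREM — not summit progress.

This is the general-degree twin of the tree's `fam_finitePart_le` / `fam_zeroSum_le`
(`Literature/…/UniformClassGroupZeroSum.lean`, imaginary quadratic fields): for a number field `K` of
degree `n > 1`, the family `F_ψ` (`ψ ∈ Ĉl_K`), the weight `g = tzTest (log x) ε` (`x^{−ν} ≤ ε ≤ 1`) and
its Laplace transform `F`, the zero terms off the exceptional segment `excRegion c K`
(`Im ρ = 0`, `Re ρ > 1 − c/(log|d_K| + log 4)`) satisfy

  `Σ_ψ Σ_{ρ ∈ u ψ, ¬exc} m_ψ(ρ) ‖F(−ρ)‖ ≤ A₀ x (e^{−cL/(4a log Q)} + e^{−√(cL/4)}) + A₀ x^{1−ν}`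

(`fam_zeroSum_le_local`), `Q = condQn K`, `L = log x ≥ a₀ log Q`, GIVEN clause (1) of the Landau–Page
package with constant `c` and the log-free density bound for the pairs `(ψ, ρ)` in `Q`-form (the shape
of `fam_density_local`); `junk_le` is used with `Q²` in place of `Q` (`h_K ≤ Q⁴`).
-/

noncomputable section

open Complex Real MeasureTheory Set Filter Topology
open scoped NumberField nonZeroDivisors

namespace Summit.QuantumAdvantage.QuantumAdvantage.Theorems.DegreeOnePrimesEscape

open Literature.NumberTheory.LFunctions Literature.NumberTheory.LFunctions.NumberField
  Literature.NumberTheory.LFunctions.EntireEF Literature.NumberTheory.LFunctions.TZWeight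
  Literature.NumberTheory.LFunctions.AbelianDensity

variable {K : Type} [Field K] [NumberField K]

/-! ### The finite part -/

set_option maxHeartbeats 800000 in
/-- **The finite part of the zero sum of the family, general degree** (Thorner–Zaman Lemmas 4.5–4.6 for
`Ĉl_K`): with the density bound in `Q`-form (`𝓠 = a log Q`, `a ≥ 1`), `c > 0`, clause (1) of the
Landau–Page package with constant `c`, `x > 1` and `T₁ ≥ 1` with `e^{b(a log Q + log(2T₁+4))} ≤ x^{1/2}`:
`Σ_ψ Σ_{ρ ∈ famFin ψ T₁, ¬exc, β ≥ 1/4} m x^{β−1}/max(1,|γ|) ≤ 64 D (e^{−cL/(4a log Q)} + e^{−√(cL/4)})`. -/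
theorem fam_finitePart_le_local {b D a : ℝ} (hb : 0 < b) (hD : 0 < D) (ha : 1 ≤ a)
    (hK : 1 < Module.finrank ℚ K)
    (hdens : ∀ (T : ℝ), 1 ≤ T → ∀ u : AddChar (Additive (ClassGroup (𝓞 K))) ℂ → Finset ℂ,
        (∀ ψ, ∀ ρ ∈ u ψ, famF K ψ ρ = 0 ∧ 1 / 4 ≤ ρ.re ∧ ρ.re < 1 ∧ |ρ.im| ≤ T) →
        ∀ α : ℝ, α ≤ 1 →
          ∑ ψ, ∑ ρ ∈ u ψ with α ≤ ρ.re, (famMult K ψ ρ : ℝ) ≤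
            D * Real.exp (b * (a * Real.log (ThornerZaman.condQn K) + Real.log (T + 4))) ^ (1 - α))
    {c : ℝ} (hc : 0 < c)
    (hpack : ∀ (χ : ClassGroup (𝓞 K) →* ℂˣ) (ρ : ℂ),
      (((χ = 1 → dedekindZeta₁ K ρ = 0) ∧ (χ ≠ 1 → classGroupLFunction₀ K χ ρ = 0)) ∧
        1 - c / (Real.log ((NumberField.discr K).natAbs : ℝ) + Real.log (|ρ.im| + 4)) < ρ.re) →
        ρ.im = 0 ∧ χ * χ = 1)
    {x T₁ : ℝ} (hx : 1 < x) (hT₁ : 1 ≤ T₁)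
    (hrange : Real.exp (b * (a * Real.log (ThornerZaman.condQn K) + Real.log (2 * T₁ + 4))) ≤
      x ^ ((1 : ℝ) / 2)) :
    ∑ ψ, ∑ ρ ∈ famFin K ψ T₁ with (¬ excRegion c K ρ ∧ 1 / 4 ≤ ρ.re),
        (famMult K ψ ρ : ℝ) * x ^ (ρ.re - 1) / max 1 |ρ.im| ≤
      64 * D * (Real.exp (-(c * Real.log x / (4 * a * Real.log (ThornerZaman.condQn K)))) +
        Real.exp (-Real.sqrt (c * Real.log x / 4))) := by
  classical
  set Q : ℝ := ThornerZaman.condQn K with hQ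
  have hQ12 : (12 : ℝ) ≤ Q := ThornerZaman.twelve_le_condQn (K := K) hK
  have hlogQ : Real.log 12 ≤ Real.log Q := Real.log_le_log (by norm_num) hQ12
  have hlog12 : (2 : ℝ) ≤ Real.log 12 := by
    rw [Real.le_log_iff_exp_le (by norm_num)]
    have := Real.exp_one_lt_d9
    have h : Real.exp 2 = Real.exp 1 * Real.exp 1 := by rw [← Real.exp_add]; norm_num
    rw [h]; nlinarith [Real.exp_pos (1:ℝ)]
  set 𝓠 : ℝ := a * Real.log Q with h𝓠
  have h𝓠1 : 1 ≤ 𝓠 := by rw [h𝓠]; nlinarith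
  set Fin' : AddChar (Additive (ClassGroup (𝓞 K))) ℂ → Finset ℂ := fun ψ ↦
    (famFin K ψ T₁).filter (fun ρ ↦ ¬ excRegion c K ρ ∧ 1 / 4 ≤ ρ.re) with hFin'
  set s : Finset (Σ _ : AddChar (Additive (ClassGroup (𝓞 K))) ℂ, ℂ) := Finset.univ.sigma Fin' with hs
  have hmem : ∀ i ∈ s, (famF K i.1 i.2 = 0 ∧ 0 < i.2.re ∧ i.2.re < 1) ∧ |i.2.im| ≤ T₁ ∧
      ¬ excRegion c K i.2 ∧ 1 / 4 ≤ i.2.re := by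
    rintro ⟨ψ, ρ⟩ hi
    rw [hs, Finset.mem_sigma] at hi
    obtain ⟨-, hρ⟩ := hi
    rw [hFin'] at hρ; dsimp only at hρ
    rw [Finset.mem_filter, mem_famFin] at hρ
    exact ⟨hρ.1.1, hρ.1.2, hρ.2.1, hρ.2.2⟩
  have hconv : ∑ ψ, ∑ ρ ∈ famFin K ψ T₁ with (¬ excRegion c K ρ ∧ 1 / 4 ≤ ρ.re),
      (famMult K ψ ρ : ℝ) * x ^ (ρ.re - 1) / max 1 |ρ.im| =
      ∑ i ∈ s, (famMult K i.1 i.2 : ℝ) * x ^ (i.2.re - 1) / max 1 |i.2.im| := by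
    rw [hs, Finset.sum_sigma]
  rw [hconv]
  have key := LinnikZeroSum.sum_rpow_div_le_of_density_zfr s (fun i ↦ i.2.re) (fun i ↦ i.2.im)
    (fun i ↦ (famMult K i.1 i.2 : ℝ)) (𝓠 := 𝓠) (c_Z := c) (b := b) (D₀ := D) (T₁ := T₁)
    hx h𝓠1 hc hb.le hD.le hT₁ (fun i _ ↦ Nat.cast_nonneg _) (fun i hi ↦ (hmem i hi).2.1) ?_ ?_ ?_
  · refine key.trans (le_of_eq ?_)
    rw [h𝓠]; congr 3; ring
  · -- zero-free region off the exceptional segment, with `𝓠 = a log Q ≥ log|d_K|`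
    intro i hi
    obtain ⟨⟨h0, -, -⟩, -, hexc, -⟩ := hmem i hi
    have h1 := re_le_of_not_excRegion hpack i.1 h0 hexc
    have hdQ : Real.log ((NumberField.discr K).natAbs : ℝ) ≤ 𝓠 := by
      have hd0 : (0 : ℝ) < ((NumberField.discr K).natAbs : ℝ) := by
        exact_mod_cast Nat.pos_of_ne_zero (Int.natAbs_ne_zero.2 (NumberField.discr_ne_zero K))
      have h2' : ((NumberField.discr K).natAbs : ℝ) ≤ Q := natAbs_discr_le_condQn K
      have h2 := Real.log_le_log hd0 h2'
      have h0Q : 0 ≤ Real.log Q := by linarith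
      rw [h𝓠]; nlinarith
    have hlog4 : 0 < Real.log (|i.2.im| + 4) := Real.log_pos (by linarith [abs_nonneg i.2.im])
    have hlogd : 0 ≤ Real.log ((NumberField.discr K).natAbs : ℝ) := Real.log_natCast_nonneg _
    have : c / (𝓠 + Real.log (|i.2.im| + 4)) ≤
        c / (Real.log ((NumberField.discr K).natAbs : ℝ) + Real.log (|i.2.im| + 4)) :=
      div_le_div_of_nonneg_left hc.le (by linarith) (by linarith)
    linarith
  · -- density
    intro T α hT hα
    have hd' := hdens T hT (fun ψ ↦ (Fin' ψ).filter (fun ρ ↦ |ρ.im| ≤ T)) (fun ψ ρ hρ ↦ ?_) α hα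
    · refine le_of_eq_of_le ?_ hd'
      rw [hs]
      rw [show (∑ i ∈ (Finset.univ.sigma Fin') with (|i.2.im| ≤ T ∧ α ≤ i.2.re), (famMult K i.1 i.2 : ℝ)) =
          ∑ i ∈ Finset.univ.sigma (fun ψ ↦ ((Fin' ψ).filter (fun ρ ↦ |ρ.im| ≤ T)).filter (fun ρ ↦ α ≤ ρ.re)),
            (famMult K i.1 i.2 : ℝ) by
        refine Finset.sum_congr ?_ fun _ _ ↦ rfl
        ext ⟨ψ, ρ⟩
        simp only [Finset.mem_filter, Finset.mem_sigma, Finset.mem_univ, true_and]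
        tauto]
      rw [Finset.sum_sigma]
    · rw [Finset.mem_filter] at hρ
      rw [hFin'] at hρ; dsimp only at hρ
      rw [Finset.mem_filter, mem_famFin] at hρ
      exact ⟨hρ.1.1.1.1, hρ.1.2.2, hρ.1.1.1.2.2, hρ.2⟩
  · rwa [h𝓠]

/-! ### The whole zero sum -/

set_option maxHeartbeats 4000000 in
/-- **Thorner–Zaman §4.3 for `Ĉl_K`, uniformly over the number fields `K` of degree `n > 1`** satisfying
the density bound in `Q`-form with constants `b, D, a`: there are `ν ∈ (0, 1/64]`, `a₀ ≥ 1`, `A₀ > 0`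
(depending on `n, b, D, a`) such that for every `c > 0`, every such `K` satisfying clause (1) of the
Landau–Page package with constant `c`, every `x ≥ Q^{a₀}`, `x^{−ν} ≤ ε ≤ 1` and all finite sets `u ψ` of
non-trivial zeros of `F_ψ`, the zero terms against the weight `tzTest (log x) ε` off the exceptional
segment satisfy
`Σ_ψ Σ_{ρ ∈ u ψ, ¬exc} m_ψ(ρ) ‖F(−ρ)‖ ≤ A₀ x (e^{−c L/(4a log Q)} + e^{−√(cL/4)}) + A₀ x^{1−ν}`. -/
theorem fam_zeroSum_le_local (n : ℕ) (hn : 1 < n) {b D a : ℝ} (hb : 0 < b) (hD : 0 < D) (ha : 1 ≤ a) :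
    ∃ ν a₀ A₀ : ℝ, 0 < ν ∧ ν ≤ 1 / 64 ∧ 1 ≤ a₀ ∧ 0 < A₀ ∧
    ∀ (c : ℝ), 0 < c → ∀ (K : Type) [Field K] [NumberField K], Module.finrank ℚ K = n →
      (∀ (χ : ClassGroup (𝓞 K) →* ℂˣ) (ρ : ℂ),
        (((χ = 1 → dedekindZeta₁ K ρ = 0) ∧ (χ ≠ 1 → classGroupLFunction₀ K χ ρ = 0)) ∧
          1 - c / (Real.log ((NumberField.discr K).natAbs : ℝ) + Real.log (|ρ.im| + 4)) < ρ.re) →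
          ρ.im = 0 ∧ χ * χ = 1) →
      (∀ (T : ℝ), 1 ≤ T → ∀ u : AddChar (Additive (ClassGroup (𝓞 K))) ℂ → Finset ℂ,
        (∀ ψ, ∀ ρ ∈ u ψ, famF K ψ ρ = 0 ∧ 1 / 4 ≤ ρ.re ∧ ρ.re < 1 ∧ |ρ.im| ≤ T) →
        ∀ α : ℝ, α ≤ 1 →
          ∑ ψ, ∑ ρ ∈ u ψ with α ≤ ρ.re, (famMult K ψ ρ : ℝ) ≤
            D * Real.exp (b * (a * Real.log (ThornerZaman.condQn K) + Real.log (T + 4))) ^ (1 - α)) →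
      ∀ x : ℝ, ThornerZaman.condQn K ^ a₀ ≤ x → ∀ ε : ℝ, x ^ (-ν) ≤ ε → ε ≤ 1 →
      ∀ u : AddChar (Additive (ClassGroup (𝓞 K))) ℂ → Finset ℂ,
        (∀ ψ, ∀ ρ ∈ u ψ, famF K ψ ρ = 0 ∧ 0 < ρ.re ∧ ρ.re < 1) →
        ∑ ψ, ∑ ρ ∈ u ψ with ¬ excRegion c K ρ,
            (famMult K ψ ρ : ℝ) * ‖fordLaplace (tzTest (Real.log x) ε) (-ρ)‖ ≤
          A₀ * x * (Real.exp (-(c * Real.log x / (4 * a * Real.log (ThornerZaman.condQn K)))) +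
              Real.exp (-Real.sqrt (c * Real.log x / 4))) + A₀ * x ^ (1 - ν) := by
  classical
  obtain ⟨M, hM1, hM⟩ := TZWeight.exists_smoothTransition_deriv_bound
  obtain ⟨hc₁16, hc₂0⟩ := tailConst_nonneg
  set β₀ : ℝ := max b 1 with hβ₀
  have hβ₀1 : 1 ≤ β₀ := le_max_right _ _
  have hbβ₀ : b ≤ β₀ := le_max_left _ _
  set ν : ℝ := 1 / (64 * β₀) with hν
  have hν0 : 0 < ν := by positivity
  have hν64 : ν ≤ 1 / 64 := by
    rw [hν]; exact one_div_le_one_div_of_le (by norm_num) (by nlinarith)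
  set a₀ : ℝ := 400 * a * β₀ with ha₀
  set W₀ : ℝ := 512 * ((n : ℝ) + 1) with hW₀
  have hW₀0 : 0 ≤ W₀ := by positivity
  set A₁ : ℝ := 50 * W₀ * (1 / ν + 1 + 8 * M) + 2 * M * W₀ * (4 * tailConst₁ + tailConst₂) with hA₁
  have hA₁0 : 0 ≤ A₁ := by
    have : 0 ≤ M := by linarith
    have : 0 ≤ tailConst₁ := by linarith
    positivity
  set A₀ : ℝ := Real.exp 1 * (512 * M * D + A₁) with hA₀
  refine ⟨ν, a₀, A₀, hν0, hν64, by rw [ha₀]; nlinarith, by positivity,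
    fun c hc K _ _ hKn hpack hdens x hx ε hεν hε1 u hu ↦ ?_⟩
  -- sizes
  have hK : 1 < Module.finrank ℚ K := by rw [hKn]; exact hn
  set Q : ℝ := ThornerZaman.condQn K with hQ
  have hQ12 : (12 : ℝ) ≤ Q := ThornerZaman.twelve_le_condQn (K := K) hK
  have hQ1 : (1 : ℝ) < Q := by linarith
  have hlog12 : (2 : ℝ) ≤ Real.log 12 := by
    rw [Real.le_log_iff_exp_le (by norm_num)]
    have := Real.exp_one_lt_d9
    have h : Real.exp 2 = Real.exp 1 * Real.exp 1 := by rw [← Real.exp_add]; norm_num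
    rw [h]; nlinarith [Real.exp_pos (1:ℝ)]
  have hlogQ : 2 ≤ Real.log Q := hlog12.trans (Real.log_le_log (by norm_num) hQ12)
  have ha₀1 : (1 : ℝ) ≤ a₀ := by rw [ha₀]; nlinarith
  have hxQ : Q ≤ x := by
    have : Q ^ (1 : ℝ) ≤ Q ^ a₀ := Real.rpow_le_rpow_of_exponent_le hQ1.le ha₀1
    rw [Real.rpow_one] at this; linarith
  have hx1 : 1 < x := by linarith
  have hx0 : 0 < x := by linarith
  set Lx : ℝ := Real.log x with hLx
  have hLQ : a₀ * Real.log Q ≤ Lx := by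
    have := Real.log_le_log (by positivity) hx
    rwa [Real.log_rpow (by linarith)] at this
  have hL800 : 800 * β₀ ≤ Lx := by nlinarith
  have hL0 : 0 < Lx := by linarith
  have hε0 : 0 < ε := lt_of_lt_of_le (Real.rpow_pos_of_pos hx0 _) hεν
  have hεL : ε < Lx / 2 := by linarith
  set T₁ : ℝ := x ^ (6 * ν) with hT₁
  have hT₁1 : 1 ≤ T₁ := Real.one_le_rpow hx1.le (by positivity)
  -- the window data of the family (`n` general)
  set A : ℝ := Real.log ((NumberField.discr K).natAbs : ℝ) + 3 * n with hAdef
  have hAnn : 0 ≤ A := by have := Real.log_natCast_nonneg (NumberField.discr K).natAbs; positivity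
  have hwin : ∀ ψ (τ : ℝ) (P : Finset ℂ), (∀ ρ ∈ P, famF K ψ ρ = 0 ∧ 0 < ρ.re ∧ ρ.re < 1 ∧ |ρ.im - τ| ≤ 1 / 2) →
      ∑ ρ ∈ P, (analyticOrderNatAt (famF K ψ) ρ : ℝ) ≤ W₀ * (A + Real.log (|τ| + 4)) := by
    intro ψ τ P hP
    have := fam_window ψ τ P hP
    rw [hKn] at this
    convert this using 2
  -- (A) per character
  set g : AddChar (Additive (ClassGroup (𝓞 K))) ℂ → ℂ → ℝ := fun ψ ρ ↦
    (famMult K ψ ρ : ℝ) * ‖fordLaplace (TZWeight.tzTest Lx ε) (-ρ)‖ with hg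
  set 𝓠 : ℝ := a * Real.log Q with h𝓠
  set S : AddChar (Additive (ClassGroup (𝓞 K))) ℂ → ℝ := fun ψ ↦
    ∑ ρ ∈ famFin K ψ T₁ with (¬ excRegion c K ρ ∧ 1 / 4 ≤ ρ.re),
      (famMult K ψ ρ : ℝ) * x ^ (ρ.re - 1) / max 1 |ρ.im| with hS
  set J : ℝ := (Lx + ε + 8 * M) * x ^ (-(3 : ℝ) / 4) * ((2 * T₁ + 3) * (W₀ * (A + Real.log (T₁ + 5)))) +
    (2 * M / ε) * T₁ ^ (-((1 : ℝ) / 2)) * (W₀ * (tailConst₁ * A + tailConst₂)) with hJ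
  have hexpL : Real.exp Lx = x := by rw [hLx, Real.exp_log hx0]
  have hM0 : 0 ≤ M := by linarith
  have hper : ∀ ψ, ∑ ρ ∈ u ψ with ¬ excRegion c K ρ, g ψ ρ ≤ Real.exp ε * x * (8 * M * S ψ + J) := by
    intro ψ
    have hdp : DecidablePred (· ∈ nontrivialZeros (famF K ψ)) := fun _ ↦ Classical.propDecidable _
    set Exc : Finset ℂ := (famFin K ψ T₁ ∪ u ψ).filter (excRegion c K) with hExc
    set u' : Finset (nontrivialZeros (famF K ψ)) :=
      ((u ψ).filter (fun ρ ↦ ¬ excRegion c K ρ)).subtype (· ∈ nontrivialZeros (famF K ψ)) with hu'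
    have key := sum_zeroTerm_le (differentiable_famF ψ) (famF_two_ne_zero ψ) (W := W₀) (A := A)
      hW₀0 hAnn (hwin ψ) hM hL0 hε0 hεL hT₁1 Exc u'
    -- the left side
    have h1 : u'.filter (fun ρ' : nontrivialZeros (famF K ψ) ↦ (ρ' : ℂ) ∉ Exc) = u' := by
      refine Finset.filter_true_of_mem fun ρ' hρ' ↦ ?_
      rw [hu', Finset.mem_subtype, Finset.mem_filter] at hρ'
      rw [hExc, Finset.mem_filter, not_and_or]
      exact Or.inr hρ'.2
    rw [h1] at key
    have hLHS : ∑ ρ' ∈ u', (analyticOrderNatAt (famF K ψ) (ρ' : ℂ) : ℝ) *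
        ‖fordLaplace (TZWeight.tzTest Lx ε) (-(ρ' : ℂ))‖ =
        ∑ ρ ∈ u ψ with ¬ excRegion c K ρ, g ψ ρ := by
      rw [hu', Finset.sum_subtype_of_mem (fun ρ : ℂ ↦ (analyticOrderNatAt (famF K ψ) ρ : ℝ) *
        ‖fordLaplace (TZWeight.tzTest Lx ε) (-ρ)‖)]
      · exact Finset.sum_congr rfl fun _ _ ↦ rfl
      intro ρ hρ
      rw [Finset.mem_filter] at hρ
      exact hu ψ ρ hρ.1
    rw [hLHS] at key
    refine key.trans ?_
    rw [hexpL]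
    refine mul_le_mul_of_nonneg_left ?_ (by positivity)
    rw [add_assoc]
    refine add_le_add ?_ ?_
    · -- the finite part: the filter `ρ ∉ Exc` is `¬ excRegion` on `famFin`
      refine mul_le_mul_of_nonneg_left (le_of_eq ?_) (by positivity)
      rw [hS]; dsimp only
      change ∑ ρ ∈ (famFin K ψ T₁).filter (fun ρ ↦ ρ ∉ Exc ∧ 1 / 4 ≤ ρ.re), _ = _
      refine Finset.sum_congr (Finset.filter_congr fun ρ hρ ↦ ?_) fun _ _ ↦ rfl
      rw [hExc, Finset.mem_filter, not_and_or]
      constructor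
      · rintro ⟨h | h, h14⟩
        · exact absurd (Finset.mem_union_left _ hρ) h
        · exact ⟨h, h14⟩
      · rintro ⟨h, h14⟩; exact ⟨Or.inr h, h14⟩
    · -- the junk of `ψ`
      rw [hJ]
      refine add_le_add (mul_le_mul_of_nonneg_left ?_ ?_) le_rfl
      · change ∑ ρ ∈ famFin K ψ T₁, (analyticOrderNatAt (famF K ψ) ρ : ℝ) ≤ _
        refine sum_mult_le_of_window hW₀0 hAnn (hwin ψ) (by linarith) _ fun ρ hρ ↦ ?_
        rw [mem_famFin] at hρ
        exact ⟨hρ.1.1, hρ.1.2.1, hρ.1.2.2, hρ.2⟩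
      · positivity
  -- (B) sum over `ψ`
  have hsum : ∑ ψ, ∑ ρ ∈ u ψ with ¬ excRegion c K ρ, g ψ ρ ≤
      Real.exp ε * x * (8 * M * ∑ ψ, S ψ + (NumberField.classNumber K : ℝ) * J) := by
    refine (Finset.sum_le_sum fun ψ _ ↦ hper ψ).trans (le_of_eq ?_)
    rw [← Finset.mul_sum, Finset.sum_add_distrib, Finset.mul_sum, Finset.sum_const, nsmul_eq_mul,
      Finset.card_univ, card_addChar_classGroup]
  -- (C) the finite part by density + ZFR
  have hrange : Real.exp (b * (a * Real.log Q + Real.log (2 * T₁ + 4))) ≤ x ^ ((1 : ℝ) / 2) := by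
    rw [show x ^ ((1 : ℝ) / 2) = Real.exp (Lx / 2) by rw [hLx, Real.rpow_def_of_pos hx0]; ring_nf]
    refine Real.exp_le_exp.2 ?_
    have hT6 : Real.log (2 * T₁ + 4) ≤ 2 + 6 * ν * Lx := by
      have h1 : Real.log (2 * T₁ + 4) ≤ Real.log (6 * T₁) :=
        Real.log_le_log (by linarith only [hT₁1]) (by linarith only [hT₁1])
      rw [Real.log_mul (by norm_num) (by linarith only [hT₁1]), hT₁, Real.log_rpow hx0, ← hLx] at h1
      have h3 : Real.log 6 ≤ 2 := by
        rw [Real.log_le_iff_le_exp (by norm_num)]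
        have := Real.exp_one_gt_d9
        have h : Real.exp 2 = Real.exp 1 * Real.exp 1 := by rw [← Real.exp_add]; norm_num
        rw [h]; nlinarith only [this]
      linarith only [h1, h3]
    have hbν : b * (6 * ν * Lx) ≤ 6 / 64 * Lx := by
      have hbν' : b * ν ≤ 1 / 64 := by
        rw [hν]; rw [show b * (1 / (64 * β₀)) = b / β₀ / 64 by ring]
        have : b / β₀ ≤ 1 := (div_le_one (by positivity)).2 hbβ₀
        linarith
      have : b * (6 * ν * Lx) = 6 * (b * ν) * Lx := by ring
      rw [this]
      have := mul_le_mul_of_nonneg_right hbν' hL0.le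
      linarith only [this]
    have hb2 : b * 2 ≤ Lx / 400 := by
      have : 1 ≤ a := ha
      nlinarith only [hbβ₀, hL800, this, hβ₀1]
    have hbQ : b * (a * Real.log Q) ≤ Lx / 400 := by
      have h0Q : 0 ≤ a * Real.log Q := by nlinarith only [hlogQ, ha]
      have h1 : b * (a * Real.log Q) ≤ β₀ * (a * Real.log Q) := mul_le_mul_of_nonneg_right hbβ₀ h0Q
      have h2' : β₀ * (a * Real.log Q) = (a₀ * Real.log Q) / 400 := by rw [ha₀]; ring
      rw [h2'] at h1
      have h3 : (a₀ * Real.log Q) / 400 ≤ Lx / 400 := by linarith only [hLQ]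
      linarith only [h1, h3]
    have h4 : b * Real.log (2 * T₁ + 4) ≤ b * 2 + b * (6 * ν * Lx) := by
      have := mul_le_mul_of_nonneg_left hT6 hb.le; linarith only [this]
    have h5 : b * (a * Real.log Q + Real.log (2 * T₁ + 4)) =
        b * (a * Real.log Q) + b * Real.log (2 * T₁ + 4) := by ring
    rw [h5]
    linarith only [hbQ, h4, hbν, hb2, hL0]
  have hfin := fam_finitePart_le_local hb hD ha hK hdens hc hpack hx1 hT₁1 hrange
  -- (D) the junk, with `Q²` in place of `Q` (`h_K ≤ Q⁴ = (Q²)²`, `(Q²)³ = Q⁶ ≤ x^ν`)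
  have hQsq12 : (12 : ℝ) ≤ Q ^ 2 := by nlinarith
  have hh : (NumberField.classNumber K : ℝ) ≤ (Q ^ 2) ^ 2 := by
    have h1 := ThornerZaman.classNumber_le_condQn_pow (K := K) hK
    rw [← hQ] at h1
    calc (NumberField.classNumber K : ℝ) ≤ Q ^ 4 := h1
      _ = (Q ^ 2) ^ 2 := by ring
  have hAQ : A ≤ 4 * Q ^ 2 := by
    have := windowConst_le_condQn K
    rw [hKn, ← hQ] at this
    rw [hAdef]
    nlinarith
  have hQ6 : (Q ^ 2) ^ 3 ≤ x ^ ν := by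
    have h1 : (Q ^ 2) ^ 3 = Real.exp (6 * Real.log Q) := by
      rw [show (Q ^ 2) ^ 3 = Q ^ 6 by ring, ← Real.rpow_natCast, Real.rpow_def_of_pos (by linarith)]
      norm_num; ring_nf
    rw [h1, Real.rpow_def_of_pos hx0, ← hLx]
    refine Real.exp_le_exp.2 ?_
    have haν : a₀ * ν = 400 * a / 64 := by rw [ha₀, hν]; field_simp
    have h2' : ν * (a₀ * Real.log Q) ≤ ν * Lx := mul_le_mul_of_nonneg_left hLQ hν0.le
    have h3 : ν * (a₀ * Real.log Q) = 400 * a / 64 * Real.log Q := by rw [← haν]; ring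
    have h0Q : 0 ≤ Real.log Q := by linarith only [hlogQ]
    nlinarith only [h2', h3, h0Q, ha]
  have hjunk : (NumberField.classNumber K : ℝ) * J ≤ A₁ * x ^ (-ν) := by
    rw [hJ, hA₁, hT₁, hLx]
    exact junk_le hν0 hν64 hQsq12 hQ6 hx1 (Nat.cast_nonneg _) hh hAnn hAQ hM1 hW₀0
      (by linarith) hc₂0 hεν hε1
  -- (E) assemble
  have hεe : Real.exp ε ≤ Real.exp 1 := Real.exp_le_exp.2 hε1
  set E : ℝ := Real.exp (-(c * Lx / (4 * 𝓠))) + Real.exp (-Real.sqrt (c * Lx / 4)) with hE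
  have hE0 : 0 ≤ E := by positivity
  have hxν : x * x ^ (-ν) = x ^ (1 - ν) := by
    rw [sub_eq_add_neg, Real.rpow_add hx0, Real.rpow_one]
  have hE' : Real.exp (-(c * Real.log x / (4 * a * Real.log (ThornerZaman.condQn K)))) +
      Real.exp (-Real.sqrt (c * Real.log x / 4)) = E := by
    rw [hE, h𝓠, hQ, hLx]; ring_nf
  have hfin' : ∑ ψ, S ψ ≤ 64 * D * E := by
    rw [hE, h𝓠, hLx]
    refine le_of_eq_of_le ?_ (hfin.trans (le_of_eq ?_))
    · rfl
    · rw [hQ]; ring_nf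
  rw [hE']
  have hgoal : ∑ ψ, ∑ ρ ∈ u ψ with ¬ excRegion c K ρ,
      (famMult K ψ ρ : ℝ) * ‖fordLaplace (tzTest (Real.log x) ε) (-ρ)‖ =
      ∑ ψ, ∑ ρ ∈ u ψ with ¬ excRegion c K ρ, g ψ ρ := by rw [hg, hLx]
  rw [hgoal]
  calc ∑ ψ, ∑ ρ ∈ u ψ with ¬ excRegion c K ρ, g ψ ρ
      ≤ Real.exp ε * x * (8 * M * ∑ ψ, S ψ + (NumberField.classNumber K : ℝ) * J) := hsum
    _ ≤ Real.exp 1 * x * (8 * M * (64 * D * E) + A₁ * x ^ (-ν)) := by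
        have hin : 0 ≤ 8 * M * ∑ ψ, S ψ + (NumberField.classNumber K : ℝ) * J := by
          have hS0 : 0 ≤ ∑ ψ, S ψ := Finset.sum_nonneg fun ψ _ ↦ by
            rw [hS]; exact Finset.sum_nonneg fun ρ _ ↦ div_nonneg (mul_nonneg (Nat.cast_nonneg _)
              (Real.rpow_nonneg hx0.le _)) (by positivity)
          have hJ0 : 0 ≤ J := by
            rw [hJ]
            have : 0 ≤ Real.log (T₁ + 5) := Real.log_nonneg (by linarith)
            have ht1 : 0 ≤ tailConst₁ := by linarith
            have : 0 ≤ tailConst₁ * A + tailConst₂ := by positivity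
            positivity
          positivity
        exact mul_le_mul (mul_le_mul_of_nonneg_right hεe hx0.le)
          (add_le_add (mul_le_mul_of_nonneg_left hfin' (by positivity)) hjunk) hin (by positivity)
    _ = Real.exp 1 * (512 * M * D) * x * E + Real.exp 1 * A₁ * x ^ (1 - ν) := by rw [← hxν]; ring
    _ ≤ A₀ * x * E + A₀ * x ^ (1 - ν) := by
        refine add_le_add ?_ ?_
        · rw [hA₀]
          have h0 : 0 ≤ Real.exp 1 * A₁ * (x * E) := by positivity
          nlinarith only [h0]
        · refine mul_le_mul_of_nonneg_right ?_ (Real.rpow_nonneg hx0.le _)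
          rw [hA₀]
          have : 0 ≤ Real.exp 1 * (512 * M * D) := by positivity
          nlinarith only [this]

end Summit.QuantumAdvantage.QuantumAdvantage.Theorems.DegreeOnePrimesEscape

end
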